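import Summits.KontsevichZagierPeriods.KontsevichZagierPeriods.Theorems.SoloBlindCauchyChartA
import HarnessLib

/-!
# Green's formula inside the rules, route A: the edge integral `∫_{x<½} P_p(x,0) dx ≡ 0`

Sorry-free.  Completes the Cauchy/Stokes theorem for the closed form `g_e(z) dz`,
`g_e(z) = (z(1-z))^{e}`, `e = p/5 - 1`, `p ∈ {1, 2}`, on the quarter-region
`D = {x < ½, y > 0}`.  Route B (file `SoloBlindCauchyStokesB`) showed `[D, h_p] ≡ 0` by
integrating in `x`; here we integrate in `y` (the Newton–Leibniz move along the compactified
fibres of `Φ_A`, file `SoloBlindCauchyChartA`) and obtain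

  `[bandA, f_A] - [baseA, -P_p(·,0)] ∈ relations`, `[bandA, f_A] ≡ [D_A, h_p] ≡ [D, h_p] ≡ 0`,

hence the **edge relation** `of (edgeRepA p hp) ∈ relations`: the admissible one-dimensional
representation `[(-∞,0) ∪ (0,½), -P_p(x,0)]` is congruent to `0` modulo the Kontsevich–Zagier
moves.  Since `-P_p(x,0) = -x^{e}(1-x)^{e}` on `(0,½)` and `= cos(πa)(-(x(1-x)))^{e}` on
`(-∞,0)` (`a = p/5`), this is the raw form of the Beta relations
`B(a,a) = 2cos(πa) B(a, 1-2a)` derived in file `SoloBlindCauchyBeta`.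
-/

noncomputable section

open Set Complex MeasureTheory Filter
open scoped ContDiff
open Literature.ModelTheory.ExponentialFields MvPolynomial
open Literature.NumberTheory.Transcendental
open Literature.NumberTheory.Transcendental.KZ

namespace Summit.KontsevichZagierPeriods.KontsevichZagierPeriods.Theorems

namespace SoloBlind

/-! ## The representations -/

/-- **`[baseA × [0,1], f_A]`**, the band form of `[D_A, h_p]`. -/
def bandRepA (p : ℕ) (hp : p = 1 ∨ p = 2) : IntegralRep 2 where
  domain := bandA
  integrand := fA p
  isSemialgebraic_domain := isSemialgebraic_bandA
  isSemialgebraicFunOn_integrand := sa_fA p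
  integrableOn := (integrableOn_fA p hp).congr_set_ae
    (ae_eq_set.2 ⟨volume_bandA_diff,
      measure_mono_null (fun _ hw => hw.2 (openBandA_subset_bandA hw.1)) measure_empty⟩)

/-- **`[baseA × (0,1), f_A]`**, its restriction to the open band. -/
def openBandRepA (p : ℕ) (hp : p = 1 ∨ p = 2) : IntegralRep 2 :=
  (bandRepA p hp).restrict openBandA isSemialgebraic_openBandA openBandA_subset_bandA

/-- The fibre primitive `t ↦ P_p(x, m(t))` is `O(1-t)` at `t = 1`. -/
theorem abs_re_gPow_le {p : ℕ} (hp : p = 1 ∨ p = 2) {x t : ℝ} (ht : t ∈ Ico (1 / 2 : ℝ) 1) :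
    |(gPow ((p : ℝ) / 5 - 1) ((x : ℂ) + (moeb t : ℝ) * I)).re| ≤ 2 * (1 - t) := by
  have he0 : (p : ℝ) / 5 - 1 ≤ 0 := by rcases hp with rfl | rfl <;> norm_num
  have he2 : (1 / 2 : ℝ) ≤ -((p : ℝ) / 5 - 1) := by rcases hp with rfl | rfl <;> norm_num
  have h1t : 0 < 1 - t := by linarith [ht.2]
  have hy : 0 < moeb t := moeb_pos (by linarith [ht.1]) ht.2
  have hb : 0 < 4 * (1 - t) ^ 2 := by positivity
  have hm : 1 / (2 * (1 - t)) ≤ moeb t := by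
    rw [moeb, div_le_div_iff₀ (by positivity) h1t]
    nlinarith [ht.1]
  have hsq : 1 / (4 * (1 - t) ^ 2) ≤ moeb t ^ 2 := by
    have h := pow_le_pow_left₀ (by positivity) hm 2
    rw [div_pow, one_pow, mul_pow, show (2 : ℝ) ^ 2 = 4 by norm_num] at h
    exact h
  calc |(gPow ((p : ℝ) / 5 - 1) ((x : ℂ) + (moeb t : ℝ) * I)).re|
      ≤ ‖gPow ((p : ℝ) / 5 - 1) ((x : ℂ) + (moeb t : ℝ) * I)‖ := abs_re_le_norm _
    _ ≤ (moeb t ^ 2) ^ ((p : ℝ) / 5 - 1) := norm_gPow_le_of_im he0 hy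
    _ ≤ 2 * (1 - t) := rpow_le_two_mul_one_sub he0 he2 ht.2 (by nlinarith [ht.1, ht.2]) hsq

/-- **Rule (3) in `t`**: `[baseA × [0,1], f_A] - [baseA, F_A(x,1) - F_A(x,0)]` is a relation,
and `F_A(x,1) - F_A(x,0) = 0 - P_p(x,0) = edgeF p x`. -/
theorem bandRepA_sub_edgeRepA (p : ℕ) (hp : p = 1 ∨ p = 2) :
    of (bandRepA p hp) - of (edgeRepA p hp) ∈ relations := by
  have e0 : ∀ (x : Fin 1 → ℝ) (t : ℝ), (Fin.snoc x t : Fin 2 → ℝ) 0 = x 0 := fun _ _ => rfl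
  have e1 : ∀ (x : Fin 1 → ℝ) (t : ℝ), (Fin.snoc x t : Fin 2 → ℝ) 1 = t := fun _ _ => rfl
  have hch : ∀ (x : Fin 1 → ℝ) (t : ℝ), chartA (Fin.snoc x t) = ![x 0, moeb t] :=
    fun x t => by funext i; fin_cases i <;> simp [chartA, e0, e1]
  have hdom : ∀ x ∈ (edgeRepA p hp).domain, x 0 < 1 / 2 ∧ x 0 ≠ 0 := fun x hx => by
    simpa [edgeRepA, mem_line, baseA] using hx
  refine newtonLeibnizRel_subset_relations ⟨1, bandRepA p hp, edgeRepA p hp, fun _ => 0,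
    fun _ => 1, FA p, sa_FA p,
    isSemialgebraicFunOn_const_of_isAlgebraic (edgeRepA p hp).isSemialgebraic_domain
      isAlgebraic_zero,
    isSemialgebraicFunOn_const_of_isAlgebraic (edgeRepA p hp).isSemialgebraic_domain
      isAlgebraic_one,
    fun _ _ => zero_le_one, ?_, ?_, ?_, ?_, rfl⟩
  · ext z
    simp only [bandRepA, bandA, mem_setOf_eq, edgeRepA, lineRep_domain, mem_line,
      Fin.init, Fin.castSucc_zero, show (Fin.last 1 : Fin 2) = 1 from rfl]
  · intro x hx
    have hx' := hdom x hx
    have hG : ∀ t : ℝ, FA p (Fin.snoc x t) =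
        if t < 1 then (gPow ((p : ℝ) / 5 - 1) ((x 0 : ℂ) + (moeb t : ℝ) * I)).re else 0 := by
      intro t
      rw [FA, e1, hch, (Pz_apply p _ _).1]
    simp only [hG]
    refine continuousOn_Icc_of_decay (c := 1 / 2) (C := 2) (by norm_num) ?_ (by simp) ?_
    · refine ContinuousOn.congr (f := fun t : ℝ =>
        (gPow ((p : ℝ) / 5 - 1) ((x 0 : ℂ) + (moeb t : ℝ) * I)).re) ?_ fun t ht => if_pos ht.2
      intro t ht
      have hm : ContinuousAt moeb t := (hasDerivAt_moeb (ne_of_lt ht.2)).continuousAt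
      by_cases h : 0 < t ∨ 0 < x 0
      · have hy : 0 < moeb t ∨ 0 < x 0 := h.imp (fun h0 => moeb_pos h0 ht.2) id
        exact (Complex.continuous_re.continuousAt.comp (ContinuousAt.comp (f := moeb)
          (continuousAt_gPow_of_pos (e := (p : ℝ) / 5 - 1) hx'.1 hy) hm)).continuousWithinAt
      · push Not at h
        have ht0 : t = 0 := le_antisymm h.1 ht.1
        have hx0 : x 0 < 0 := lt_of_le_of_ne h.2 hx'.2
        subst ht0
        have hg : ContinuousWithinAt (fun y : ℝ => gPow ((p : ℝ) / 5 - 1) ((x 0 : ℂ) + y * I))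
            (Ici 0) (moeb 0) := by
          rw [moeb_zero]
          exact continuousWithinAt_gPow_neg hx0
        exact Complex.continuous_re.continuousAt.comp_continuousWithinAt
          (hg.comp hm.continuousWithinAt fun s hs => moeb_nonneg hs.1 hs.2)
    · intro t ht
      rw [if_pos ht.2]
      exact abs_re_gPow_le hp ht
  · intro x hx t ht
    have hx' := hdom x hx
    have hz : wOf ((x 0 : ℂ) + (moeb t : ℝ) * I) ∈ slitPlane :=
      wOf_mem_slitPlane hx'.1 (moeb_pos ht.1 ht.2)
    have hφ : HasDerivAt moeb (1 / (1 - t) ^ 2) t := hasDerivAt_moeb (ne_of_lt ht.2)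
    have hcomp : HasDerivAt
        (fun s : ℝ => (gPow ((p : ℝ) / 5 - 1) ((x 0 : ℂ) + (moeb s : ℝ) * I)).re)
        (-(gDer ((p : ℝ) / 5 - 1) ((x 0 : ℂ) + (moeb t : ℝ) * I)).im * (1 / (1 - t) ^ 2)) t :=
      HasDerivAt.comp t (hasDerivAt_re_gPow hz) hφ
    have hev : (fun s : ℝ => FA p (Fin.snoc x s)) =ᶠ[nhds t]
        fun s : ℝ => (gPow ((p : ℝ) / 5 - 1) ((x 0 : ℂ) + (moeb s : ℝ) * I)).re := by
      filter_upwards [Iio_mem_nhds ht.2] with s hs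
      rw [FA, e1, if_pos (show s < 1 from hs), hch, (Pz_apply p _ _).1]
    refine (hcomp.congr_of_eventuallyEq hev).congr_deriv ?_
    show _ = fA p (Fin.snoc x t)
    rw [fA, e1, if_pos ht.2, hch, (Pz_apply p _ _).2.2]
    ring
  · intro x hx
    simp only [edgeRepA, lineRep_integrand, edgeF]
    rw [FA, FA, e1, e1, if_neg (lt_irrefl _), if_pos zero_lt_one, hch, moeb_zero, zero_sub]

/-! ## Conclusion -/

/-- `[D_A, h_p] ≡ 0` (from route B and the null line `x = 0`). -/
theorem of_cauchyRepA_mem (p : ℕ) (hp : p = 1 ∨ p = 2) : of (cauchyRepA p hp) ∈ relations := by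
  simpa using relations.sub_mem (of_cauchyRep_mem_relations p hp) (cauchyRep_sub_cauchyRepA p hp)

/-- **Rule (2) along `Φ_A`**: `[baseA × (0,1), f_A] ≡ [D_A, h_p]`. -/
theorem openBandRepA_equivalent (p : ℕ) (hp : p = 1 ∨ p = 2) :
    Equivalent (openBandRepA p hp) (cauchyRepA p hp) :=
  equivalent_of_chart (f := fA p) (g := Hz p) (J := fun w => 1 / (1 - w 1) ^ 2)
    (isSemialgebraicMapOn_chartA isSemialgebraic_openBandA fun w hw => ne_of_lt hw.2.2)
    (fun w hw => hasFDerivAt_chartA (ne_of_lt hw.2.2)) (injOn_chartA.mono fun w hw => hw.2.2)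
    image_chartA (fun w _ => abs_det_chartADeriv w)
    (fun w hw => by simp [fA, hw.2.2, div_eq_mul_inv]) rfl (fun _ _ => rfl) rfl (fun _ _ => rfl)

/-- `[baseA × (0,1), f_A] ≡ 0`. -/
theorem of_openBandRepA_mem (p : ℕ) (hp : p = 1 ∨ p = 2) :
    of (openBandRepA p hp) ∈ relations := by
  simpa using relations.add_mem (openBandRepA_equivalent p hp) (of_cauchyRepA_mem p hp)

/-- `[baseA × [0,1], f_A] ≡ 0` (null modification). -/
theorem of_bandRepA_mem (p : ℕ) (hp : p = 1 ∨ p = 2) : of (bandRepA p hp) ∈ relations := by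
  have h1 : of (bandRepA p hp) - of (openBandRepA p hp) ∈ relations :=
    (bandRepA p hp).of_sub_of_restrict_mem_relations isSemialgebraic_openBandA
      openBandA_subset_bandA volume_bandA_diff
  simpa using relations.add_mem h1 (of_openBandRepA_mem p hp)

/-- **Green's formula inside the rules (route A): the edge relation**
`[(-∞,0) ∪ (0,½), -P_p(x,0)] ≡ 0` for `p = 1, 2`. -/
theorem of_edgeRepA_mem_relations (p : ℕ) (hp : p = 1 ∨ p = 2) :
    of (edgeRepA p hp) ∈ relations := by
  simpa using relations.sub_mem (of_bandRepA_mem p hp) (bandRepA_sub_edgeRepA p hp)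

end SoloBlind

end Summit.KontsevichZagierPeriods.KontsevichZagierPeriods.Theorems
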